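import Summits.FinalStateConjecture.FinalStateConjecture.Theorems.PhotonSphereChannelsEnergyInequalities

/-!
# Route PhotonSphereChannels — null (`κ = ±1`) balance laws, the weighted transport identity on boxes
# and the resulting weighted null-energy estimate

Helper file for sub-goal `stub_compactExhaustionOfLocalDecay` of stub H4 of line `isolated-kerr-connected-hull`
(crux stmt-FinalStateConjecture-14075).  For a `C²` solution `u` of `u_tt − u_xx + V u = 0`, `V ∈ C¹`, and a
sign `κ`, `κ² = 1`: `e_κ = (u_t + κu_x)² + Vu²`, `p_κ = κ((u_t + κu_x)² − Vu²)` satisfy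
`∂ₜ e_κ = ∂ₓ p_κ + κ V′ u²` (`fderiv_nullDensity_eq`); Green's formula for `(w e_κ, −w p_κ)` on a box
`[t₁,t₂] × [p,q]`, `w ∈ C¹`, gives the **weighted transport identity** `weighted_identity_box` (the `1+1`
Dafermos–Rodnianski `r^p`, `p = 1`, identity), and, where `κw′ ≥ c` and `−κ(wV)′ ≥ cV` off a compact
interval on which `∫∫ u²` is a priori bounded, the estimate `weighted_box_estimate` of
`∫∫ ((u_t + κu_x)² + Vu²)`.  Also: bookkeeping for iterated interval integrals of continuous functions
over boxes (`integral2_*`).  Densities are passed as functions with defining hypotheses. [folklore]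
-/

namespace Summit.FinalStateConjecture.FinalStateConjecture.Theorems

-- every `Summit.FinalStateConjecture.FinalStateConjecture.…` name repeats the summit = sub-problem
-- segment (D-0017 layout), as in every landed `…Theorems` file of this route
set_option linter.dupNamespace false

open MeasureTheory Set Filter Topology intervalIntegral

noncomputable section

namespace WaveEnergy

variable {u : ℝ × ℝ → ℝ} {V : ℝ → ℝ} {κ : ℝ}

/-- `∂ₜ e_κ` along a `t`-slice: `2 (u_t + κ u_x)(u_tt + κ u_tx) + 2 V u u_t`. [folklore] -/
theorem hasDerivAt_nullDensity_slice_fst (hu : ContDiff ℝ 2 u) (κ : ℝ) {eκ : ℝ × ℝ → ℝ}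
    (heκ : ∀ z, eκ z = (fderiv ℝ u z (1, 0) + κ * fderiv ℝ u z (0, 1)) ^ 2 + V z.2 * u z ^ 2)
    (t x : ℝ) :
    HasDerivAt (fun τ => eκ (τ, x))
      (2 * (fderiv ℝ u (t, x) (1, 0) + κ * fderiv ℝ u (t, x) (0, 1))
          * (fderiv ℝ (fderiv ℝ u) (t, x) (1, 0) (1, 0)
            + κ * fderiv ℝ (fderiv ℝ u) (t, x) (1, 0) (0, 1))
        + V x * (2 * u (t, x) * fderiv ℝ u (t, x) (1, 0))) t := by
  have h1 := hasDerivAt_fderiv_apply_slice_fst hu (1, 0) t x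
  have h2 := hasDerivAt_fderiv_apply_slice_fst hu (0, 1) t x
  have h3 := hasDerivAt_slice_fst (differentiable_of_contDiff_two hu) t x
  have h := ((h1.add (h2.const_mul κ)).pow 2).add ((h3.pow 2).const_mul (V x))
  rw [show (fun τ => eκ (τ, x)) = _ from funext fun τ => heκ (τ, x)]
  refine h.congr_deriv ?_
  simp only [Pi.add_apply]
  push_cast
  ring

/-- `∂ₓ p_κ` along an `x`-slice: `κ (2 (u_t + κ u_x)(u_xt + κ u_xx) − (V′ u² + 2 V u u_x))`. [folklore] -/
theorem hasDerivAt_nullMomentum_slice_snd (hu : ContDiff ℝ 2 u) (hV : Differentiable ℝ V) (κ : ℝ)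
    {pκ : ℝ × ℝ → ℝ}
    (hpκ : ∀ z, pκ z = κ * ((fderiv ℝ u z (1, 0) + κ * fderiv ℝ u z (0, 1)) ^ 2 - V z.2 * u z ^ 2))
    (t x : ℝ) :
    HasDerivAt (fun y => pκ (t, y))
      (κ * (2 * (fderiv ℝ u (t, x) (1, 0) + κ * fderiv ℝ u (t, x) (0, 1))
          * (fderiv ℝ (fderiv ℝ u) (t, x) (0, 1) (1, 0)
            + κ * fderiv ℝ (fderiv ℝ u) (t, x) (0, 1) (0, 1))
        - (deriv V x * u (t, x) ^ 2 + V x * (2 * u (t, x) * fderiv ℝ u (t, x) (0, 1))))) x := by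
  have h1 := hasDerivAt_fderiv_apply_slice_snd hu (1, 0) t x
  have h2 := hasDerivAt_fderiv_apply_slice_snd hu (0, 1) t x
  have h3 := hasDerivAt_slice_snd (differentiable_of_contDiff_two hu) t x
  have hVd : HasDerivAt V (deriv V x) x := (hV x).hasDerivAt
  have h := (((h1.add (h2.const_mul κ)).pow 2).sub (hVd.mul (h3.pow 2))).const_mul κ
  rw [show (fun y => pκ (t, y)) = _ from funext fun y => hpκ (t, y)]
  refine h.congr_deriv ?_
  simp only [Pi.add_apply, Pi.pow_apply]
  push_cast
  ring

/-- The null energy density `e_κ` is differentiable (`u ∈ C²`, `V` differentiable). [folklore] -/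
theorem differentiable_nullDensity (hu : ContDiff ℝ 2 u) (hV : Differentiable ℝ V) (κ : ℝ)
    {eκ : ℝ × ℝ → ℝ}
    (heκ : ∀ z, eκ z = (fderiv ℝ u z (1, 0) + κ * fderiv ℝ u z (0, 1)) ^ 2 + V z.2 * u z ^ 2) :
    Differentiable ℝ eκ := by
  have h1 := differentiable_fderiv_apply hu (1, 0)
  have h2 := differentiable_fderiv_apply hu (0, 1)
  have h4 : Differentiable ℝ (fun z : ℝ × ℝ => V z.2) := hV.comp differentiable_snd
  rw [show eκ = _ from funext heκ]
  exact ((h1.add (h2.const_mul κ)).pow 2).add (h4.mul ((differentiable_of_contDiff_two hu).pow 2))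

/-- The null momentum density `p_κ` is differentiable (`u ∈ C²`, `V` differentiable). [folklore] -/
theorem differentiable_nullMomentum (hu : ContDiff ℝ 2 u) (hV : Differentiable ℝ V) (κ : ℝ)
    {pκ : ℝ × ℝ → ℝ}
    (hpκ : ∀ z, pκ z = κ * ((fderiv ℝ u z (1, 0) + κ * fderiv ℝ u z (0, 1)) ^ 2 - V z.2 * u z ^ 2)) :
    Differentiable ℝ pκ := by
  have h1 := differentiable_fderiv_apply hu (1, 0)
  have h2 := differentiable_fderiv_apply hu (0, 1)
  have h4 : Differentiable ℝ (fun z : ℝ × ℝ => V z.2) := hV.comp differentiable_snd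
  rw [show pκ = _ from funext hpκ]
  exact (((h1.add (h2.const_mul κ)).pow 2).sub
    (h4.mul ((differentiable_of_contDiff_two hu).pow 2))).const_mul κ

/-- **The null balance law.** For a `C²` solution of `u_tt − u_xx + V u = 0` (`V` differentiable) and
`κ² = 1`: `∂e_κ(z)(1,0) = ∂p_κ(z)(0,1) + κ V′(x) u(z)²` (with `Φ = u_t + κ u_x`:
`∂ₜ(Φ²) − κ∂ₓ(Φ²) = 2Φ(u_tt − u_xx) = −2VuΦ`, `(∂ₜ + κ∂ₓ)(Vu²) = 2VuΦ + κV′u²`). [folklore] -/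
theorem fderiv_nullDensity_eq (hu : ContDiff ℝ 2 u) (hV : Differentiable ℝ V) (hκ : κ ^ 2 = 1)
    (hsol : ∀ z : ℝ × ℝ, fderiv ℝ (fderiv ℝ u) z (1, 0) (1, 0)
      - fderiv ℝ (fderiv ℝ u) z (0, 1) (0, 1) + V z.2 * u z = 0)
    {eκ pκ : ℝ × ℝ → ℝ}
    (heκ : ∀ z, eκ z = (fderiv ℝ u z (1, 0) + κ * fderiv ℝ u z (0, 1)) ^ 2 + V z.2 * u z ^ 2)
    (hpκ : ∀ z, pκ z = κ * ((fderiv ℝ u z (1, 0) + κ * fderiv ℝ u z (0, 1)) ^ 2 - V z.2 * u z ^ 2))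
    (z : ℝ × ℝ) :
    fderiv ℝ eκ z (1, 0) = fderiv ℝ pκ z (0, 1) + κ * (deriv V z.2 * u z ^ 2) := by
  obtain ⟨t, x⟩ := z
  have hE := (hasDerivAt_slice_fst (differentiable_nullDensity hu hV κ heκ) t x).unique
    (hasDerivAt_nullDensity_slice_fst hu κ heκ t x)
  have hM := (hasDerivAt_slice_snd (differentiable_nullMomentum hu hV κ hpκ) t x).unique
    (hasDerivAt_nullMomentum_slice_snd hu hV κ hpκ t x)
  rw [hE, hM]
  have hsymm := fderiv_fderiv_symm hu (t, x) (1, 0) (0, 1)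
  have hs := hsol (t, x)
  simp only at hs ⊢
  linear_combination (2 * (fderiv ℝ u (t, x) (1, 0) + κ * fderiv ℝ u (t, x) (0, 1))) * hs
    + (2 * κ * (fderiv ℝ u (t, x) (1, 0) + κ * fderiv ℝ u (t, x) (0, 1))) * hsymm
    + (-(2 * (fderiv ℝ u (t, x) (1, 0) + κ * fderiv ℝ u (t, x) (0, 1))
        * fderiv ℝ (fderiv ℝ u) (t, x) (0, 1) (0, 1))) * hκ

/-- The weighted source `κ[(w V′ + w′ V) u² − w′ (u_t + κ u_x)²]` is continuous
(`u ∈ C²`, `V ∈ C¹`, `w ∈ C¹`). [folklore] -/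
theorem continuous_weightedSource (hu : ContDiff ℝ 2 u) (hV : ContDiff ℝ 1 V) (κ : ℝ)
    {w w' : ℝ → ℝ} (hw : ∀ x, HasDerivAt w (w' x) x) (hw' : Continuous w') :
    Continuous fun z : ℝ × ℝ =>
      κ * ((w z.2 * deriv V z.2 + w' z.2 * V z.2) * u z ^ 2
        - w' z.2 * (fderiv ℝ u z (1, 0) + κ * fderiv ℝ u z (0, 1)) ^ 2) := by
  have hwc : Continuous w := continuous_iff_continuousAt.2 fun x => (hw x).continuousAt
  have hVc : Continuous V := hV.continuous
  have hV'c : Continuous (deriv V) := hV.continuous_deriv le_rfl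
  have huc : Continuous u := (differentiable_of_contDiff_two hu).continuous
  have h1 := continuous_fderiv_apply hu (1, 0)
  have h2 := continuous_fderiv_apply hu (0, 1)
  fun_prop

/-- **Weighted transport identity on a box.** Let `u` be a `C²` solution of `u_tt − u_xx + V u = 0` on
`ℝ × ℝ` with `V ∈ C¹`, `κ² = 1`, `e_κ = (u_t + κu_x)² + Vu²`, `p_κ = κ((u_t + κu_x)² − Vu²)` (hypotheses
`heκ`, `hpκ`) and `w ∈ C¹(ℝ)` with derivative `w'`.  Then for every box `[t₁, t₂] × [p, q]` (oriented
integrals, no ordering hypotheses):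
`∫_p^q w e_κ(t₂,·) − ∫_p^q w e_κ(t₁,·) = ∫_{t₁}^{t₂} [w(q) p_κ(t,q) − w(p) p_κ(t,p)] dt
  + ∫_{t₁}^{t₂} ∫_p^q κ [(w V′ + w′ V) u² − w′ (u_t + κ u_x)²] dx dt`.
(Green's formula for `F = w e_κ`, `G = −w p_κ`: `div = w(∂ₜe_κ − ∂ₓp_κ) − w′p_κ`.) [folklore] -/
theorem weighted_identity_box (hu : ContDiff ℝ 2 u) (hV : ContDiff ℝ 1 V) (hκ : κ ^ 2 = 1)
    (hsol : ∀ z : ℝ × ℝ, fderiv ℝ (fderiv ℝ u) z (1, 0) (1, 0)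
      - fderiv ℝ (fderiv ℝ u) z (0, 1) (0, 1) + V z.2 * u z = 0)
    {eκ pκ : ℝ × ℝ → ℝ}
    (heκ : ∀ z, eκ z = (fderiv ℝ u z (1, 0) + κ * fderiv ℝ u z (0, 1)) ^ 2 + V z.2 * u z ^ 2)
    (hpκ : ∀ z, pκ z = κ * ((fderiv ℝ u z (1, 0) + κ * fderiv ℝ u z (0, 1)) ^ 2 - V z.2 * u z ^ 2))
    {w w' : ℝ → ℝ} (hw : ∀ x, HasDerivAt w (w' x) x) (hw' : Continuous w') (p q t₁ t₂ : ℝ) :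
    (∫ x in p..q, w x * eκ (t₂, x)) - ∫ x in p..q, w x * eκ (t₁, x)
      = (∫ t in t₁..t₂, (w q * pκ (t, q) - w p * pκ (t, p)))
        + ∫ t in t₁..t₂, ∫ x in p..q,
            κ * ((w x * deriv V x + w' x * V x) * u (t, x) ^ 2
              - w' x * (fderiv ℝ u (t, x) (1, 0) + κ * fderiv ℝ u (t, x) (0, 1)) ^ 2) := by
  have hVd : Differentiable ℝ V := hV.differentiable one_ne_zero
  have hed := differentiable_nullDensity hu hVd κ heκ
  have hmd := differentiable_nullMomentum hu hVd κ hpκ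
  have hwd : Differentiable ℝ w := fun x => (hw x).differentiableAt
  have hcons : ∀ z, fderiv ℝ eκ z (1, 0) = fderiv ℝ pκ z (0, 1) + κ * (deriv V z.2 * u z ^ 2) :=
    fderiv_nullDensity_eq hu hVd hκ hsol heκ hpκ
  -- the pair `(F, G) = (w e_κ, −w p_κ)`
  set F : ℝ × ℝ → ℝ := fun z => w z.2 * eκ z with hF
  set G : ℝ × ℝ → ℝ := fun z => -(w z.2 * pκ z) with hG
  have hFd : Differentiable ℝ F := (hwd.comp differentiable_snd).mul hed
  have hGd : Differentiable ℝ G := ((hwd.comp differentiable_snd).mul hmd).neg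
  -- its divergence
  set src : ℝ × ℝ → ℝ := fun z =>
    κ * ((w z.2 * deriv V z.2 + w' z.2 * V z.2) * u z ^ 2
      - w' z.2 * (fderiv ℝ u z (1, 0) + κ * fderiv ℝ u z (0, 1)) ^ 2) with hsrc
  have hsrcc : Continuous src := continuous_weightedSource hu hV κ hw hw'
  have hdiv : ∀ t x : ℝ, fderiv ℝ F (t, x) (1, 0) + fderiv ℝ G (t, x) (0, 1) = src (t, x) := by
    intro t x
    -- `t`-slice of `F`: `w x * ∂ₜ e_κ`
    have hFs : HasDerivAt (fun τ => F (τ, x)) (w x * fderiv ℝ eκ (t, x) (1, 0)) t :=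
      (hasDerivAt_slice_fst hed t x).const_mul (w x)
    -- `x`-slice of `G`: `−(w′ p_κ + w ∂ₓ p_κ)`
    have hGs : HasDerivAt (fun y => G (t, y))
        (-(w' x * pκ (t, x) + w x * fderiv ℝ pκ (t, x) (0, 1))) x :=
      ((hw x).mul (hasDerivAt_slice_snd hmd t x)).neg
    have h1 := (hasDerivAt_slice_fst hFd t x).unique hFs
    have h2 := (hasDerivAt_slice_snd hGd t x).unique hGs
    rw [h1, h2, hcons (t, x), hpκ (t, x)]
    simp only [hsrc]
    ring
  -- Green's formula on the box `[t₁, t₂] × [p, q]`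
  have hdivfun : (fun z : ℝ × ℝ => fderiv ℝ F z (1, 0) + fderiv ℝ G z (0, 1)) = src :=
    funext fun z => hdiv z.1 z.2
  have key := integral2_divergence_prod_of_hasFDerivAt F G (fderiv ℝ F) (fderiv ℝ G) t₁ p t₂ q
    hFd.continuous.continuousOn hGd.continuous.continuousOn
    (fun z _ => (hFd z).hasFDerivAt) (fun z _ => (hGd z).hasFDerivAt)
    (by
      rw [hdivfun]
      exact hsrcc.continuousOn.integrableOn_compact (isCompact_uIcc.prod isCompact_uIcc))
  have hlhs : (∫ t in t₁..t₂, ∫ x in p..q, fderiv ℝ F (t, x) (1, 0) + fderiv ℝ G (t, x) (0, 1))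
      = ∫ t in t₁..t₂, ∫ x in p..q, src (t, x) := by
    refine intervalIntegral.integral_congr fun t _ => ?_
    exact intervalIntegral.integral_congr fun x _ => hdiv t x
  rw [hlhs] at key
  -- the boundary terms
  have hGq : (∫ t in t₁..t₂, G (t, q)) - ∫ t in t₁..t₂, G (t, p)
      = -∫ t in t₁..t₂, (w q * pκ (t, q) - w p * pκ (t, p)) := by
    have hi1 : IntervalIntegrable (fun t => G (t, q)) volume t₁ t₂ :=
      (hGd.continuous.comp (Continuous.prodMk_left q)).intervalIntegrable _ _
    have hi2 : IntervalIntegrable (fun t => G (t, p)) volume t₁ t₂ :=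
      (hGd.continuous.comp (Continuous.prodMk_left p)).intervalIntegrable _ _
    rw [← intervalIntegral.integral_sub hi1 hi2, ← intervalIntegral.integral_neg]
    refine intervalIntegral.integral_congr fun t _ => ?_
    simp only [hG]
    ring
  rw [hGq] at key
  simp only [hF] at key
  linarith

section DoubleIntegral

variable {g h : ℝ × ℝ → ℝ}

/-- Slices of a continuous function on `ℝ × ℝ` are interval integrable. -/
theorem intervalIntegrable_slice (hg : Continuous g) (t p q : ℝ) :
    IntervalIntegrable (fun x => g (t, x)) volume p q :=
  (hg.comp (Continuous.prodMk_right t)).intervalIntegrable p q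

/-- The inner integral `t ↦ ∫_p^q g(t, x) dx` of a continuous function is continuous. -/
theorem continuous_inner_integral (hg : Continuous g) (p q : ℝ) :
    Continuous fun t => ∫ x in p..q, g (t, x) :=
  intervalIntegral.continuous_parametric_intervalIntegral_of_continuous' (f := fun t x => g (t, x))
    (hg.comp (continuous_fst.prodMk continuous_snd)) p q

/-- Monotonicity of the box integral under a pointwise bound on the box (`0 ≤ T`, `p ≤ q`). -/
theorem integral2_mono_on (hg : Continuous g) (hh : Continuous h) {T p q : ℝ} (hT : 0 ≤ T)
    (hpq : p ≤ q) (hle : ∀ t ∈ Icc 0 T, ∀ x ∈ Icc p q, g (t, x) ≤ h (t, x)) :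
    (∫ t in (0 : ℝ)..T, ∫ x in p..q, g (t, x)) ≤ ∫ t in (0 : ℝ)..T, ∫ x in p..q, h (t, x) :=
  intervalIntegral.integral_mono_on hT ((continuous_inner_integral hg p q).intervalIntegrable _ _)
    ((continuous_inner_integral hh p q).intervalIntegrable _ _) fun t ht =>
      intervalIntegral.integral_mono_on hpq (intervalIntegrable_slice hg t p q)
        (intervalIntegrable_slice hh t p q) fun x hx => hle t ht x hx

/-- Splitting the box integral at `x = m`. -/
theorem integral2_split (hg : Continuous g) (T p m q : ℝ) :
    (∫ t in (0 : ℝ)..T, ∫ x in p..q, g (t, x))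
      = (∫ t in (0 : ℝ)..T, ∫ x in p..m, g (t, x)) + ∫ t in (0 : ℝ)..T, ∫ x in m..q, g (t, x) := by
  rw [← intervalIntegral.integral_add ((continuous_inner_integral hg p m).intervalIntegrable _ _)
    ((continuous_inner_integral hg m q).intervalIntegrable _ _)]
  exact intervalIntegral.integral_congr fun t _ =>
    (intervalIntegral.integral_add_adjacent_intervals (intervalIntegrable_slice hg t p m)
      (intervalIntegrable_slice hg t m q)).symm

/-- Additivity of the box integral. -/
theorem integral2_add (hg : Continuous g) (hh : Continuous h) (T p q : ℝ) :
    (∫ t in (0 : ℝ)..T, ∫ x in p..q, (g (t, x) + h (t, x)))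
      = (∫ t in (0 : ℝ)..T, ∫ x in p..q, g (t, x)) + ∫ t in (0 : ℝ)..T, ∫ x in p..q, h (t, x) := by
  rw [← intervalIntegral.integral_add ((continuous_inner_integral hg p q).intervalIntegrable _ _)
    ((continuous_inner_integral hh p q).intervalIntegrable _ _)]
  exact intervalIntegral.integral_congr fun t _ =>
    intervalIntegral.integral_add (intervalIntegrable_slice hg t p q) (intervalIntegrable_slice hh t p q)

/-- Constants come out of the box integral. -/
theorem integral2_const_mul (c T p q : ℝ) :
    (∫ t in (0 : ℝ)..T, ∫ x in p..q, c * g (t, x)) = c * ∫ t in (0 : ℝ)..T, ∫ x in p..q, g (t, x) := by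
  rw [← intervalIntegral.integral_const_mul]
  exact intervalIntegral.integral_congr fun t _ => intervalIntegral.integral_const_mul c _

end DoubleIntegral

/-- **Weighted null-energy estimate on a box.** In the setting of `weighted_identity_box` (`V ≥ 0`), let
`p ≤ m₁ ≤ m₂ ≤ q`, `0 ≤ T`; suppose the boundary terms vanish (`w(p)p_κ(t,p) = w(q)p_κ(t,q) = 0`,
`t ∈ [0,T]`), `w ≥ 0`, `κw′ ≥ c > 0` on `[p,q]`, `cV ≤ −κ(wV′ + w′V)` on `[p,m₁] ∪ [m₂,q]` (repulsive ends),
`−κ(wV′ + w′V) ≥ −C`, `V ≤ V₁` on `[m₁,m₂]` and `∫_0^T ∫_{m₁}^{m₂} u² ≤ K`.  Then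
`∫_0^T ∫_p^q ((u_t + κu_x)² + Vu²) ≤ (∫_p^q w e_κ(0,·) + (C + cV₁)K)/c`. [folklore] -/
theorem weighted_box_estimate (hu : ContDiff ℝ 2 u) (hV : ContDiff ℝ 1 V) (hV0 : ∀ x, 0 ≤ V x)
    (hκ : κ ^ 2 = 1)
    (hsol : ∀ z : ℝ × ℝ, fderiv ℝ (fderiv ℝ u) z (1, 0) (1, 0)
      - fderiv ℝ (fderiv ℝ u) z (0, 1) (0, 1) + V z.2 * u z = 0)
    {eκ pκ : ℝ × ℝ → ℝ}
    (heκ : ∀ z, eκ z = (fderiv ℝ u z (1, 0) + κ * fderiv ℝ u z (0, 1)) ^ 2 + V z.2 * u z ^ 2)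
    (hpκ : ∀ z, pκ z = κ * ((fderiv ℝ u z (1, 0) + κ * fderiv ℝ u z (0, 1)) ^ 2 - V z.2 * u z ^ 2))
    {w w' : ℝ → ℝ} (hw : ∀ x, HasDerivAt w (w' x) x) (hw' : Continuous w')
    {p m₁ m₂ q T c C V₁ K : ℝ} (hpm : p ≤ m₁) (hm : m₁ ≤ m₂) (hmq : m₂ ≤ q) (hT : 0 ≤ T)
    (hbp : ∀ t ∈ Icc 0 T, w p * pκ (t, p) = 0) (hbq : ∀ t ∈ Icc 0 T, w q * pκ (t, q) = 0)
    (hw0 : ∀ x ∈ Icc p q, 0 ≤ w x) (hc : 0 < c) (hcw : ∀ x ∈ Icc p q, c ≤ κ * w' x)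
    (hfar : ∀ x ∈ Icc p m₁ ∪ Icc m₂ q, c * V x ≤ -(κ * (w x * deriv V x + w' x * V x)))
    (hC : 0 ≤ C) (hnear : ∀ x ∈ Icc m₁ m₂, -C ≤ -(κ * (w x * deriv V x + w' x * V x)))
    (hV₁ : ∀ x ∈ Icc m₁ m₂, V x ≤ V₁) (hK : (∫ t in (0 : ℝ)..T, ∫ x in m₁..m₂, u (t, x) ^ 2) ≤ K) :
    (∫ t in (0 : ℝ)..T, ∫ x in p..q,
        ((fderiv ℝ u (t, x) (1, 0) + κ * fderiv ℝ u (t, x) (0, 1)) ^ 2 + V x * u (t, x) ^ 2))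
      ≤ ((∫ x in p..q, w x * eκ (0, x)) + (C + c * V₁) * K) / c := by
  have hpq : p ≤ q := hpm.trans (hm.trans hmq)
  have huc : Continuous u := (differentiable_of_contDiff_two hu).continuous
  have hΦc : Continuous fun z : ℝ × ℝ => fderiv ℝ u z (1, 0) + κ * fderiv ℝ u z (0, 1) :=
    (continuous_fderiv_apply hu (1, 0)).add (continuous_const.mul (continuous_fderiv_apply hu (0, 1)))
  have hVc : Continuous fun z : ℝ × ℝ => V z.2 := hV.continuous.comp continuous_snd
  -- the identity with vanishing boundary terms
  set src : ℝ × ℝ → ℝ := fun z =>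
    κ * ((w z.2 * deriv V z.2 + w' z.2 * V z.2) * u z ^ 2
      - w' z.2 * (fderiv ℝ u z (1, 0) + κ * fderiv ℝ u z (0, 1)) ^ 2) with hsrc
  have hsrcc : Continuous src := continuous_weightedSource hu hV κ hw hw'
  have key := weighted_identity_box hu hV hκ hsol heκ hpκ hw hw' p q 0 T
  have hbdry : (∫ t in (0 : ℝ)..T, (w q * pκ (t, q) - w p * pκ (t, p))) = 0 := by
    rw [intervalIntegral.integral_congr (g := fun _ => (0 : ℝ)) fun t ht => ?_]
    · simp
    · rw [uIcc_of_le hT] at ht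
      simp only [hbq t ht, hbp t ht, sub_zero]
  rw [hbdry, zero_add] at key
  -- `∫∫ (−src) ≤ E_w(0)`
  have hET : 0 ≤ ∫ x in p..q, w x * eκ (T, x) :=
    intervalIntegral.integral_nonneg hpq fun x hx => mul_nonneg (hw0 x hx) (by
      rw [heκ]; have := hV0 x; positivity)
  have hneg : (∫ t in (0 : ℝ)..T, ∫ x in p..q, -src (t, x)) ≤ ∫ x in p..q, w x * eκ (0, x) := by
    have : (∫ t in (0 : ℝ)..T, ∫ x in p..q, -src (t, x)) = -∫ t in (0 : ℝ)..T, ∫ x in p..q, src (t, x) := by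
      rw [← intervalIntegral.integral_neg]
      exact intervalIntegral.integral_congr fun t _ => intervalIntegral.integral_neg
    rw [this]
    linarith
  -- the good and the bad densities
  set good : ℝ × ℝ → ℝ := fun z =>
    c * (fderiv ℝ u z (1, 0) + κ * fderiv ℝ u z (0, 1)) ^ 2 + c * (V z.2 * u z ^ 2) with hgood
  set bad : ℝ × ℝ → ℝ := fun z => (C + c * V₁) * u z ^ 2 with hbad
  have hgoodc : Continuous good := (continuous_const.mul (hΦc.pow 2)).add
    (continuous_const.mul (hVc.mul (huc.pow 2)))
  have hbadc : Continuous bad := continuous_const.mul (huc.pow 2)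
  have hnsc : Continuous fun z => -src z := hsrcc.neg
  -- pointwise comparisons
  have hpt_far : ∀ t x, x ∈ Icc p m₁ ∪ Icc m₂ q → x ∈ Icc p q → good (t, x) ≤ -src (t, x) := by
    intro t x hx hx'
    have h1 := hfar x hx
    have h2 := hcw x hx'
    have h3 : 0 ≤ V x * u (t, x) ^ 2 := mul_nonneg (hV0 x) (sq_nonneg _)
    simp only [hgood, hsrc]
    nlinarith [sq_nonneg (fderiv ℝ u (t, x) (1, 0) + κ * fderiv ℝ u (t, x) (0, 1)),
      mul_le_mul_of_nonneg_right h1 (sq_nonneg (u (t, x))),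
      mul_le_mul_of_nonneg_right h2 (sq_nonneg (fderiv ℝ u (t, x) (1, 0) + κ * fderiv ℝ u (t, x) (0, 1)))]
  have hpt_near : ∀ t, ∀ x ∈ Icc m₁ m₂, good (t, x) ≤ -src (t, x) + bad (t, x) := by
    intro t x hx
    have hx' : x ∈ Icc p q := ⟨hpm.trans hx.1, hx.2.trans hmq⟩
    have h1 := hnear x hx
    have h2 := hcw x hx'
    have h4 := hV₁ x hx
    have h3 : 0 ≤ u (t, x) ^ 2 := sq_nonneg _
    simp only [hgood, hsrc, hbad]
    nlinarith [sq_nonneg (fderiv ℝ u (t, x) (1, 0) + κ * fderiv ℝ u (t, x) (0, 1)),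
      mul_le_mul_of_nonneg_right h1 h3, mul_le_mul_of_nonneg_right h4 h3,
      mul_le_mul_of_nonneg_right h2 (sq_nonneg (fderiv ℝ u (t, x) (1, 0) + κ * fderiv ℝ u (t, x) (0, 1))),
      mul_nonneg hc.le (mul_nonneg (sub_nonneg.2 h4) h3)]
  -- integrate: `∫∫ good ≤ ∫∫ (−src) + ∫∫_{near} bad`
  have hI : (∫ t in (0 : ℝ)..T, ∫ x in p..q, good (t, x))
      ≤ (∫ t in (0 : ℝ)..T, ∫ x in p..q, -src (t, x)) + ∫ t in (0 : ℝ)..T, ∫ x in m₁..m₂, bad (t, x) := by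
    rw [integral2_split hgoodc T p m₁ q, integral2_split hgoodc T m₁ m₂ q,
      integral2_split hnsc T p m₁ q, integral2_split hnsc T m₁ m₂ q]
    have i1 := integral2_mono_on hgoodc hnsc hT hpm fun t _ x hx => hpt_far t x (Or.inl hx)
      ⟨hx.1, hx.2.trans (hm.trans hmq)⟩
    have i3 := integral2_mono_on hgoodc hnsc hT hmq fun t _ x hx => hpt_far t x (Or.inr hx)
      ⟨hpm.trans (hm.trans hx.1), hx.2⟩
    have i2 := integral2_mono_on (h := fun z => -src z + bad z) hgoodc (hnsc.add hbadc) hT hm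
      fun t _ x hx => hpt_near t x hx
    rw [integral2_add hnsc hbadc] at i2
    linarith
  have hbadK : (∫ t in (0 : ℝ)..T, ∫ x in m₁..m₂, bad (t, x)) ≤ (C + c * V₁) * K := by
    have h1 : (∫ t in (0 : ℝ)..T, ∫ x in m₁..m₂, bad (t, x))
        = (C + c * V₁) * ∫ t in (0 : ℝ)..T, ∫ x in m₁..m₂, u (t, x) ^ 2 :=
      integral2_const_mul (g := fun z => u z ^ 2) (C + c * V₁) T m₁ m₂
    have hV₁0 : 0 ≤ V₁ := (hV0 m₁).trans (hV₁ m₁ ⟨le_rfl, hm⟩)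
    rw [h1]
    exact mul_le_mul_of_nonneg_left hK (by positivity)
  -- conclude
  have hgoal : (∫ t in (0 : ℝ)..T, ∫ x in p..q,
      ((fderiv ℝ u (t, x) (1, 0) + κ * fderiv ℝ u (t, x) (0, 1)) ^ 2 + V x * u (t, x) ^ 2))
      = (∫ t in (0 : ℝ)..T, ∫ x in p..q, good (t, x)) / c := by
    rw [eq_div_iff hc.ne', mul_comm]
    refine Eq.trans (integral2_const_mul (g := fun z =>
      (fderiv ℝ u z (1, 0) + κ * fderiv ℝ u z (0, 1)) ^ 2 + V z.2 * u z ^ 2) c T p q).symm ?_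
    refine intervalIntegral.integral_congr fun t _ => intervalIntegral.integral_congr fun x _ => ?_
    simp only [hgood]
    ring
  rw [hgoal]
  exact div_le_div_of_nonneg_right (by linarith) hc.le

/-- **Registered sub-goal `stub_h4WeightedTransport`** (crux stmt-FinalStateConjecture-14075, line
`isolated-kerr-connected-hull`, towards `stub_compactExhaustionOfLocalDecay`): the weighted transport
identity on boxes for the null densities `e_κ`, `p_κ` (`κ² = 1`). [folklore] -/
theorem stub_h4WeightedTransport : ∀ (u : ℝ × ℝ → ℝ) (V : ℝ → ℝ) (κ : ℝ), ContDiff ℝ 2 u →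
    ContDiff ℝ 1 V → κ ^ 2 = 1 → (∀ z : ℝ × ℝ, fderiv ℝ (fderiv ℝ u) z (1, 0) (1, 0)
      - fderiv ℝ (fderiv ℝ u) z (0, 1) (0, 1) + V z.2 * u z = 0) → ∀ (w w' : ℝ → ℝ),
    (∀ x, HasDerivAt w (w' x) x) → Continuous w' → ∀ (p q t₁ t₂ : ℝ),
    (∫ x in p..q, w x * ((fderiv ℝ u (t₂, x) (1, 0) + κ * fderiv ℝ u (t₂, x) (0, 1)) ^ 2
        + V x * u (t₂, x) ^ 2)) - ∫ x in p..q, w x * ((fderiv ℝ u (t₁, x) (1, 0)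
        + κ * fderiv ℝ u (t₁, x) (0, 1)) ^ 2 + V x * u (t₁, x) ^ 2)
      = (∫ t in t₁..t₂, (w q * (κ * ((fderiv ℝ u (t, q) (1, 0) + κ * fderiv ℝ u (t, q) (0, 1)) ^ 2
            - V q * u (t, q) ^ 2)) - w p * (κ * ((fderiv ℝ u (t, p) (1, 0)
            + κ * fderiv ℝ u (t, p) (0, 1)) ^ 2 - V p * u (t, p) ^ 2))))
        + ∫ t in t₁..t₂, ∫ x in p..q, κ * ((w x * deriv V x + w' x * V x) * u (t, x) ^ 2
            - w' x * (fderiv ℝ u (t, x) (1, 0) + κ * fderiv ℝ u (t, x) (0, 1)) ^ 2) :=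
  fun _ _ _ hu hV hκ hsol _ _ hw hw' p q t₁ t₂ =>
    weighted_identity_box hu hV hκ hsol (fun _ => rfl) (fun _ => rfl) hw hw' p q t₁ t₂

end WaveEnergy

end

end Summit.FinalStateConjecture.FinalStateConjecture.Theorems
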